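import Summits.AnomalousDissipation.AnomalousDissipation.Theorems.SolenoidalFractalHomogenisationLagrangianStepOneLevelSplitApi
import Literature.Analysis.FunctionSpaces.TorusCubeCutoffCommutator
import HarnessLib

/-!
# W3-E (ii) `stub_effectiveFrameEnergyL_bandKill`: the DUALITY STEP and the `cutLp` ↔ Fourier-mode conversions
# (helper for K1L_D `stmt-AnomalousDissipation-27980`; `--supports`, F-k3l-7/8)

Summits-side helper file (everything proved; no definitions, no named facts).  The band-kill estimates of the window propagator come from the
Literature chain (`PassiveVectorTensorPropagatorBandKill(Approx)`, `…BandKillAdjoint(Approx)`) in the currency "Fourier coefficients of the datum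
vanish on the ball `|k| ≤ L`" and "`Σ_{|k| ≤ L'} |𝓕(T y)(k)|²`, `‖T y‖²`"; the registered stub speaks of the cut `cutLp` of `…OneLevelSplitDefs`
and of `‖T y − cutLp L (T y)‖`, `‖y − cutLp L' y‖`.  This file bridges the two, for an ARBITRARY bounded operator `T` on `V2 = L²(𝕋³; ℝ³)`:

* §1 `cutLp` as an orthogonal projection in Fourier terms: `norm_cutLp_sq_eq_sum` (`‖cutLp N y‖² = Σ_{|k|≤N} |ŷ(k)|²`),
  `mFourierCoeff_eq_zero_of_cutLp_eq_zero`, `mFourierCoeff_sub_cutLp_eq_zero` (the modes of `y − cutLp N y` vanish on the ball),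
  `inner_cutLp_comm` (symmetry), `norm_sub_cutLp_sq_eq_inner`, `cubeSupp_subset_freqBall` (`cube(R) ⊆ ball(L)` when `2R ≤ L` in `𝕋³`);
* §2 THE DUALITY STEP `norm_sub_cutLp_apply_le_of_adjoint_bounds`: if `‖T† z‖ ≤ α‖z‖` and `‖cutLp L' (T† z)‖ ≤ ε‖z‖` for every `z` with no modes in
  the ball `|k| ≤ L`, then `‖T y − cutLp L (T y)‖ ≤ α ‖y − cutLp L' y‖ + ε ‖y‖` for every `y` (test `T y − cutLp L (T y)` against itself);
  and the direct step `norm_apply_le_of_cutLp_eq_zero`;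
* §3 conversions from the squared currency: `norm_cutLp_le_of_sum_le`, `norm_le_of_sq_le_add` (`‖v‖² ≤ (e^{−ρ} + ε²)‖y‖² ⇒ ‖v‖ ≤ (e^{−ρ/2} + ε)‖y‖`).

Infrastructure for route-1's rung leaf F-D1.A0 (a frontier FORMAL rung); NOT a proof of anomalous dissipation.
-/

set_option linter.dupNamespace false

namespace Summit.AnomalousDissipation.AnomalousDissipation.Theorems.SolenoidalFractalHomogenisation.LagrangianStep

open Literature.Analysis Literature.Analysis.FluidPDE Literature.Analysis.FunctionSpaces
open MeasureTheory Set Filter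
open scoped ENNReal NNReal InnerProductSpace

noncomputable section

namespace OneLevelSplit

/-! ## §1 The cut in Fourier terms -/

/-- `‖cutLp N y‖² = Σ_{|k| ≤ N} |ŷ(k)|²`. -/
theorem norm_cutLp_sq_eq_sum (N : ℕ) (y : V2) :
    ‖cutLp N y‖ ^ 2 = ∑ k ∈ Torus.freqBall N, ‖UnitAddTorus.mFourierCoeff (EuclideanSpace.complexify ∘ (y : VF)) k‖ ^ 2 := by
  rw [norm_cutLp_sq, Torus.fourierTruncate_eq,
    Torus.integral_norm_sq_realTrigPoly Torus.neg_mem_freqBall_of_mem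
      (Torus.isConjSymm_mFourierCoeff ((Lp.memLp y).integrable one_le_two))]

/-- If the cut vanishes, the datum has no modes in the ball. -/
theorem mFourierCoeff_eq_zero_of_cutLp_eq_zero {N : ℕ} {y : V2} (hy : cutLp N y = 0) :
    ∀ k ∈ Torus.freqBall N, UnitAddTorus.mFourierCoeff (EuclideanSpace.complexify ∘ (y : VF)) k = 0 := by
  have h := norm_cutLp_sq_eq_sum N y
  rw [hy, norm_zero, zero_pow two_ne_zero] at h
  intro k hk
  have h0 := (Finset.sum_eq_zero_iff_of_nonneg fun k _ => sq_nonneg _).1 h.symm k hk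
  exact norm_eq_zero.1 (pow_eq_zero_iff two_ne_zero |>.1 h0)

/-- The modes of `y − cutLp N y` vanish on the ball. -/
theorem mFourierCoeff_sub_cutLp_eq_zero (N : ℕ) (y : V2) :
    ∀ k ∈ Torus.freqBall N, UnitAddTorus.mFourierCoeff (EuclideanSpace.complexify ∘ (((y - cutLp N y : V2)) : VF)) k = 0 := by
  intro k hk
  have hae : (EuclideanSpace.complexify ∘ (((y - cutLp N y : V2)) : VF)) =ᵐ[volume]
      (EuclideanSpace.complexify ∘ (-(Torus.fourierTruncate N (y : VF) - (y : VF)))) := by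
    filter_upwards [Lp.coeFn_sub y (cutLp N y), coeFn_cutLp N y] with x hx hc
    simp only [Function.comp_apply]
    rw [hx, Pi.sub_apply, hc, Pi.neg_apply, Pi.sub_apply, neg_sub]
  have hneg : ∀ f : UnitAddTorus (Fin 3) → EuclideanSpace ℂ (Fin 3),
      UnitAddTorus.mFourierCoeff (-f) k = -UnitAddTorus.mFourierCoeff f k := fun f => by
    simp [UnitAddTorus.mFourierCoeff, integral_neg]
  have e : (EuclideanSpace.complexify ∘ (-(Torus.fourierTruncate N (y : VF) - (y : VF)))) =
      -(EuclideanSpace.complexify ∘ (Torus.fourierTruncate N (y : VF) - (y : VF))) := by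
    funext x; simp only [Function.comp_apply, Pi.neg_apply, map_neg]
  rw [Torus.mFourierCoeff_congr_ae hae k, e, hneg,
    Torus.mFourierCoeff_fourierTruncate_sub ((Lp.memLp y).integrable one_le_two) N k, if_pos hk, neg_zero]

/-- `⟪y, cutLp N u⟫ = Σ_{|k|≤N} Re⟪ŷ(k), û(k)⟫`. -/
theorem inner_cutLp_eq_sum (N : ℕ) (y u : V2) :
    ⟪y, cutLp N u⟫_ℝ = ∑ k ∈ Torus.freqBall N, (inner ℂ (UnitAddTorus.mFourierCoeff (EuclideanSpace.complexify ∘ (y : VF)) k)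
      (UnitAddTorus.mFourierCoeff (EuclideanSpace.complexify ∘ (u : VF)) k)).re := by
  rw [MeasureTheory.L2.inner_def]
  have h1 : ∫ x, ⟪(y : VF) x, ((cutLp N u : V2) : VF) x⟫_ℝ = ∫ x, ⟪(y : VF) x, Torus.fourierTruncate N (u : VF) x⟫_ℝ :=
    integral_congr_ae (by filter_upwards [coeFn_cutLp N u] with x hx; rw [hx])
  rw [h1, Torus.fourierTruncate_eq, Torus.integral_inner_realTrigPoly_right Torus.neg_mem_freqBall_of_mem
    (Torus.isConjSymm_mFourierCoeff ((Lp.memLp u).integrable one_le_two)) (Lp.memLp y)]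

/-- **Symmetry of the cut**: `⟪cutLp N y, u⟫ = ⟪y, cutLp N u⟫`. -/
theorem inner_cutLp_comm (N : ℕ) (y u : V2) : ⟪cutLp N y, u⟫_ℝ = ⟪y, cutLp N u⟫_ℝ := by
  rw [real_inner_comm, inner_cutLp_eq_sum, inner_cutLp_eq_sum]
  refine Finset.sum_congr rfl fun k _ => ?_
  rw [← inner_conj_symm, Complex.conj_re]

/-- `‖v − cutLp N v‖² = ⟪v, v − cutLp N v⟫`. -/
theorem norm_sub_cutLp_sq_eq_inner (N : ℕ) (v : V2) : ‖v - cutLp N v‖ ^ 2 = ⟪v, v - cutLp N v⟫_ℝ := by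
  rw [norm_sub_cutLp_sq, inner_sub_right, real_inner_self_eq_norm_sq, inner_cutLp_self]

/-- In `𝕋³`, the cube `‖k‖_∞ ≤ R` lies in the ball `|k| ≤ L` as soon as `2R ≤ L`. -/
theorem cubeSupp_subset_freqBall {R L : ℕ} (h : 2 * R ≤ L) : Torus.cubeSupp (Fin 3) R ⊆ Torus.freqBall L := by
  intro k hk
  rw [Torus.mem_cubeSupp] at hk
  rw [Torus.mem_freqBall, Torus.freqNormSq]
  have hR : ∀ i, ((k i : ℤ) : ℝ) ^ 2 ≤ (R : ℝ) ^ 2 := fun i => by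
    have := hk i
    have h1 : |((k i : ℤ) : ℝ)| ≤ R := by exact_mod_cast this
    calc ((k i : ℤ) : ℝ) ^ 2 = |((k i : ℤ) : ℝ)| ^ 2 := (sq_abs _).symm
      _ ≤ (R : ℝ) ^ 2 := pow_le_pow_left₀ (abs_nonneg _) h1 2
  have hL : (2 * R : ℝ) ≤ L := by exact_mod_cast h
  calc ∑ i, ((k i : ℤ) : ℝ) ^ 2 ≤ ∑ _i : Fin 3, (R : ℝ) ^ 2 := Finset.sum_le_sum fun i _ => hR i
    _ = 3 * (R : ℝ) ^ 2 := by simp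
    _ ≤ (2 * R) ^ 2 := by nlinarith [sq_nonneg (R : ℝ)]
    _ ≤ (L : ℝ) ^ 2 := pow_le_pow_left₀ (by positivity) hL 2

/-! ## §2 The duality step -/

/-- **THE DUALITY STEP** for the band kill (ii-out): if, for every `z` with no Fourier modes in the ball `|k| ≤ L`, the adjoint satisfies
`‖T† z‖ ≤ α ‖z‖` and `‖cutLp L' (T† z)‖ ≤ ε ‖z‖`, then `‖T y − cutLp L (T y)‖ ≤ α ‖y − cutLp L' y‖ + ε ‖y‖` for EVERY `y`. -/
theorem norm_sub_cutLp_apply_le_of_adjoint_bounds (T : V2 →L[ℝ] V2) {L L' : ℕ} {α ε : ℝ} (hα : 0 ≤ α) (hε : 0 ≤ ε)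
    (h1 : ∀ z : V2, (∀ k ∈ Torus.freqBall L, UnitAddTorus.mFourierCoeff (EuclideanSpace.complexify ∘ (z : VF)) k = 0) →
      ‖ContinuousLinearMap.adjoint T z‖ ≤ α * ‖z‖)
    (h2 : ∀ z : V2, (∀ k ∈ Torus.freqBall L, UnitAddTorus.mFourierCoeff (EuclideanSpace.complexify ∘ (z : VF)) k = 0) →
      ‖cutLp L' (ContinuousLinearMap.adjoint T z)‖ ≤ ε * ‖z‖)
    (y : V2) : ‖T y - cutLp L (T y)‖ ≤ α * ‖y - cutLp L' y‖ + ε * ‖y‖ := by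
  have hzoff := mFourierCoeff_sub_cutLp_eq_zero L (T y)
  have hsq0 := norm_sub_cutLp_sq_eq_inner L (T y)
  obtain ⟨z, hz⟩ : ∃ z : V2, T y - cutLp L (T y) = z := ⟨_, rfl⟩
  rw [hz] at hzoff hsq0 ⊢
  have hA := h1 z hzoff
  have hB := h2 z hzoff
  -- `‖z‖² = ⟪T y, z⟫ = ⟪y, T† z⟫ = ⟪y − Q'y, T†z⟫ + ⟪y, Q'(T†z)⟫`
  have hsq : ‖z‖ ^ 2 = ⟪y - cutLp L' y, ContinuousLinearMap.adjoint T z⟫_ℝ + ⟪y, cutLp L' (ContinuousLinearMap.adjoint T z)⟫_ℝ := by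
    rw [hsq0, ← ContinuousLinearMap.adjoint_inner_right, inner_sub_left, ← inner_cutLp_comm]
    ring
  have hle : ‖z‖ ^ 2 ≤ (α * ‖y - cutLp L' y‖ + ε * ‖y‖) * ‖z‖ := by
    rw [hsq]
    calc ⟪y - cutLp L' y, ContinuousLinearMap.adjoint T z⟫_ℝ + ⟪y, cutLp L' (ContinuousLinearMap.adjoint T z)⟫_ℝ
        ≤ ‖y - cutLp L' y‖ * ‖ContinuousLinearMap.adjoint T z‖ + ‖y‖ * ‖cutLp L' (ContinuousLinearMap.adjoint T z)‖ :=
          add_le_add (real_inner_le_norm _ _) (real_inner_le_norm _ _)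
      _ ≤ ‖y - cutLp L' y‖ * (α * ‖z‖) + ‖y‖ * (ε * ‖z‖) :=
          add_le_add (mul_le_mul_of_nonneg_left hA (norm_nonneg _)) (mul_le_mul_of_nonneg_left hB (norm_nonneg _))
      _ = (α * ‖y - cutLp L' y‖ + ε * ‖y‖) * ‖z‖ := by ring
  rcases (norm_nonneg z).eq_or_lt with h0 | hpos
  · rw [← h0]; positivity
  · have : ‖z‖ * ‖z‖ ≤ (α * ‖y - cutLp L' y‖ + ε * ‖y‖) * ‖z‖ := by rw [← sq]; exact hle
    exact le_of_mul_le_mul_right this hpos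

/-- **The direct step** (ii-in): if `‖T z‖ ≤ α ‖z‖` for every `z` with no modes in the ball `|k| ≤ L`, then `‖T y‖ ≤ α ‖y‖` whenever `cutLp L y = 0`. -/
theorem norm_apply_le_of_cutLp_eq_zero (T : V2 →L[ℝ] V2) {L : ℕ} {α : ℝ}
    (h1 : ∀ z : V2, (∀ k ∈ Torus.freqBall L, UnitAddTorus.mFourierCoeff (EuclideanSpace.complexify ∘ (z : VF)) k = 0) → ‖T z‖ ≤ α * ‖z‖)
    (y : V2) (hy : cutLp L y = 0) : ‖T y‖ ≤ α * ‖y‖ :=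
  h1 y (mFourierCoeff_eq_zero_of_cutLp_eq_zero hy)

/-! ## §3 Conversions from the squared currency -/

/-- `Σ_{|k| ≤ L'} |𝓕v(k)|² ≤ ε² ‖y‖²` gives `‖cutLp L' v‖ ≤ ε ‖y‖`. -/
theorem norm_cutLp_le_of_sum_le {L' : ℕ} {v y : V2} {ε : ℝ} (hε : 0 ≤ ε)
    (h : ∑ k ∈ Torus.freqBall L', ‖UnitAddTorus.mFourierCoeff (EuclideanSpace.complexify ∘ (v : VF)) k‖ ^ 2 ≤ ε ^ 2 * ‖y‖ ^ 2) :
    ‖cutLp L' v‖ ≤ ε * ‖y‖ := by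
  have h1 : ‖cutLp L' v‖ ^ 2 ≤ (ε * ‖y‖) ^ 2 := by rw [norm_cutLp_sq_eq_sum, mul_pow]; exact h
  exact (pow_le_pow_iff_left₀ (norm_nonneg _) (by positivity) two_ne_zero).1 h1

/-- `‖v‖² ≤ (e^{−ρ} + ε²) ‖y‖²` gives `‖v‖ ≤ (e^{−ρ/2} + ε) ‖y‖`. -/
theorem norm_le_of_sq_le_exp_add {v y : V2} {ρ ε : ℝ} (hε : 0 ≤ ε)
    (h : ‖v‖ ^ 2 ≤ (Real.exp (-ρ) + ε ^ 2) * ‖y‖ ^ 2) : ‖v‖ ≤ (Real.exp (-(ρ / 2)) + ε) * ‖y‖ := by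
  have he : Real.exp (-ρ) = Real.exp (-(ρ / 2)) ^ 2 := by rw [← Real.exp_nat_mul]; ring_nf
  have h0 : 0 ≤ (Real.exp (-(ρ / 2)) + ε) * ‖y‖ := by positivity
  have h1 : ‖v‖ ^ 2 ≤ ((Real.exp (-(ρ / 2)) + ε) * ‖y‖) ^ 2 := by
    refine h.trans ?_
    rw [he, mul_pow]
    refine mul_le_mul_of_nonneg_right ?_ (sq_nonneg _)
    nlinarith [Real.exp_pos (-(ρ / 2)), sq_nonneg ε]
  exact (pow_le_pow_iff_left₀ (norm_nonneg _) h0 two_ne_zero).1 h1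

end OneLevelSplit

end

end Summit.AnomalousDissipation.AnomalousDissipation.Theorems.SolenoidalFractalHomogenisation.LagrangianStep
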